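import Summits.KontsevichZagierPeriods.Zeta5Search.Barrier.ConeGammaTranslateRateBall

/-!
# ζ(5) search — BARRIER: THE LEXICOGRAPHIC GERM OF THE TRANSLATE INTEGRAL — one-sided derivatives and kinks of `P` at EVERY
# translate of the rate ball; at a simple rate wall the kink is an integer multiple of the wall covector bounded by the junction
# count (file (4) of «THE LEXICOGRAPHIC GERM»)

HONEST FRAMING (cell `pub-zeta5`): systematic search; no irrationality claim unless kernel-certified. MODEL objects
under Brown–Zudilin's (28)+(30) accounting ([BZ22] = arXiv:2210.03391; (28) observed, not proved); nothing here is a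
statement about `ζ(5)`, any `γ` of record, the cone's supremum (C2 OPEN) or the value / sign of `P`, of a derivative, a kink, a wall
defect or a junction count at a named direction (DATA of the cell); the rate-ball radius at a named direction is DATA; NO
cancellation is quantified; S-E / (TD_A) stay CONJECTURED; records in print UNMOVED. Prover P2 g42 (item «THE LEXICOGRAPHIC GERM»,
file (4); plan INBOX 2026-08-28). Sources: files (1)–(3) of the item (`ConeGammaCuspSlopeLexGerm`, `ConeGammaCuspSlopeLexWall`,
`ConeGammaTranslateRateBall`), P2 g33 `ConeGammaCuspPeriodCanonical` (chamber formula), P2 g40 `ConeGammaTranslateGeneric` (the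
`HasFDerivAt` packaging), P2 g41 `ConeGammaTranslateUnitKink` (the unit kink away from the coherence ball — contrasted, not used).

SETTING. `a` with all 28 forms positive, `T > 0` a period, `P = translateIntegral a T`, `σ = cuspSlope a T`, `F` the canonical
period pattern function, rates `r_k(θ) = φ_k(θ)/h_k(a)`; the OPEN RATE BALL: `|r_k(δ)| < ρ̄` for all `k`, with
`2ρ̄·T·x_max² < 1`, `2ρ̄·x_max < 1`, `2ρ̄·x_max < wallDist a T`. By file (3), `P = P(0) + σ` on the closed ball, so:
* `continuous_phiForm`, `rates_le_of_abs_le` — a segment `δ + t·Δ`, `|t| ≤ t₀`, from a translate of the open ball stays in the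
  closed ball;
* **`translateIntegral_add_smul_eq_of_lex` — THE LEXICOGRAPHIC GERM OF `P`**: for EVERY translate `δ` of the open ball, EVERY `Δ`
  and every generic `δ₀` refining the lexicographic order of `(δ, Δ)`: **`P(δ + t·Δ) = P(δ) + t·Σ_k W_k(δ₀)·r_k(Δ)` on `[0, t₀]`**;
  **`hasDerivWithinAt_translateIntegral_of_lex`** — the one-sided directional derivative of `P` exists at every translate of the
  ball, along every direction, and is a canonical chamber functional (P2 g41 had the two-sided derivative at GENERIC coherent
  translates; at a translate with ties the one-sided derivatives along `Δ` and `−Δ` are the functionals of two different chambers);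
* **`translateIntegral_symm_add_smul_eq_of_lex` — THE KINK OF `P` AT A RESONANT TRANSLATE**:
  `P(δ + t·Δ) + P(δ − t·Δ) − 2P(δ) = t·Σ_k (W_k(δ₀⁺) − W_k(δ₀⁻))·r_k(Δ)` on `[0, t₀]` — P2 g40's `translateIntegral_symm_diff` (no
  kink at a translate with a margin) is the case `δ₀⁺ = δ₀⁻`;
* **`translateIntegral_kink_of_simple_rate_wall` — AT A SIMPLE RATE WALL THE KINK OF `P` IS AN INTEGER MULTIPLE OF THE WALL
  COVECTOR, BOUNDED BY THE JUNCTION COUNT**: if `ρ_{k₁}(δ) = ρ_{k₂}(δ)` is the ONLY tie of `δ` and `Δ` splits it, then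
  `P(δ + t·Δ) + P(δ − t·Δ) − 2P(δ) = t·m·(r_{k₂}(Δ) − r_{k₁}(Δ))` on `[0, t₀]` with `m = m_F ∈ ℤ` the pooled wall defect and
  **`|m| ≤ #{junctions b of the period : b·h_{k₁}(a), b·h_{k₂}(a) ∈ ℤ}`** — NOT a unit: at a rate wall of a coherent translate the
  crossings of `k₁` and `k₂` swap SIMULTANEOUSLY at every common junction of the period, one unit exchange each (P2 g41's
  `jumpMass_sub_of_swap` is ONE swapped pair, away from the ball); this is P2 g41's menu (f) «multiple resonances» near the orbit;
* **`hasFDerivAt_translateIntegral_of_rates_lt`** — at a translate of the open ball with pairwise distinct rates, ZERO RATES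
  ALLOWED, `P` is Fréchet-differentiable with derivative the canonical chamber functional of `δ` (the hyperplanes `φ_k = 0` are
  invisible to `P` inside the ball; P2 g41's margin-free form needed non-zero rates for its margin).
NOT here (honest): any value at a named direction (DATA); ties of higher multiplicity; the translate arrangement beyond the ball
((TD_A) CONJECTURED); `Φ`, `γ`, C2, S-E's truth, `ζ(5)`.
-/

noncomputable section

open Set Finset Filter
open scoped Topology

namespace Summit.KontsevichZagierPeriods.Zeta5Search.Barrier.ConeGamma

/-! ### Segments from the open ball stay in the closed ball -/

/-- Each form is continuous in the displacement (`2`-Lipschitz in the sup norm). -/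
theorem continuous_phiForm (k : Fin 28) : Continuous fun θ : Fin 8 → ℝ => phiForm θ k := by
  refine (LipschitzWith.of_dist_le' (K := 2) fun θ θ' => ?_).continuous
  rw [Real.dist_eq, dist_eq_norm]
  have e : phiForm θ k - phiForm θ' k = phiForm (θ - θ') k := by
    have h := phiForm_add (θ - θ') θ' k
    rw [sub_add_cancel] at h
    linarith
  rw [e]
  exact abs_phiForm_le_two_mul_norm _ k

/-- **A short segment from a translate of the OPEN rate ball stays in the closed ball**: if `|r_k(δ)| < ρ̄` for all `k`, then for
every `Δ` there is `t₀ > 0` with `|r_k(δ + t·Δ)| ≤ ρ̄` for all `|t| ≤ t₀` and all `k`. -/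
theorem rates_le_of_abs_le {a : Dir} {δ : Fin 8 → ℝ} {ρb : ℝ} (hρ : ∀ k, |phiForm δ k / h28 a k| < ρb)
    (Δ : Fin 8 → ℝ) : ∃ t₀ : ℝ, 0 < t₀ ∧ ∀ t : ℝ, |t| ≤ t₀ → ∀ k, |phiForm (δ + t • Δ) k / h28 a k| ≤ ρb := by
  classical
  obtain ⟨t₀, ht₀⟩ : ∃ t₀ : ℝ, t₀ = (Finset.univ : Finset (Fin 28)).inf' Finset.univ_nonempty
      fun k => (ρb - |phiForm δ k / h28 a k|) / (|phiForm Δ k / h28 a k| + 1) := ⟨_, rfl⟩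
  have ht₀pos : 0 < t₀ := by
    rw [ht₀, Finset.lt_inf'_iff]
    exact fun k _ => div_pos (by linarith [hρ k]) (by positivity)
  have ht₀le : ∀ k, t₀ ≤ (ρb - |phiForm δ k / h28 a k|) / (|phiForm Δ k / h28 a k| + 1) := fun k => by
    rw [ht₀]
    exact Finset.inf'_le (fun k => (ρb - |phiForm δ k / h28 a k|) / (|phiForm Δ k / h28 a k| + 1)) (Finset.mem_univ k)
  refine ⟨t₀, ht₀pos, fun t ht k => ?_⟩
  have hq : 0 < |phiForm Δ k / h28 a k| + 1 := by positivity
  have h1 : |t| * |phiForm Δ k / h28 a k| ≤ ρb - |phiForm δ k / h28 a k| := by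
    have h2 : |t| * |phiForm Δ k / h28 a k| ≤ t₀ * (|phiForm Δ k / h28 a k| + 1) :=
      mul_le_mul ht (by linarith) (abs_nonneg _) ht₀pos.le
    have h3 : t₀ * (|phiForm Δ k / h28 a k| + 1) ≤ ρb - |phiForm δ k / h28 a k| := by
      have := ht₀le k
      rwa [le_div_iff₀ hq] at this
    exact h2.trans h3
  rw [rate_add_smul]
  calc |phiForm δ k / h28 a k + t * (phiForm Δ k / h28 a k)| ≤
      |phiForm δ k / h28 a k| + |t * (phiForm Δ k / h28 a k)| := abs_add_le _ _
    _ = |phiForm δ k / h28 a k| + |t| * |phiForm Δ k / h28 a k| := by rw [abs_mul]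
    _ ≤ ρb := by linarith

/-! ### THE LEXICOGRAPHIC GERM of the translate integral -/

/-- **THE LEXICOGRAPHIC GERM OF `P`.** All 28 forms of `a` positive, `T > 0` a period, `F` the canonical period pattern function;
`δ` a translate of the OPEN rate ball (`|r_k(δ)| < ρ̄`, `2ρ̄·T·x_max² < 1`, `2ρ̄·x_max < 1`, `2ρ̄·x_max < wallDist a T`), `Δ` ANY
direction, `δ₀` a generic reference refining the lexicographic order of `(δ, Δ)`. Then there is `t₀ > 0` with
**`P(δ + t·Δ) = P(δ) + t·Σ_k (F(P≤(k)) − F(P<(k)))·φ_k(Δ)/h_k(a)` for all `t ∈ [0, t₀]`** (the sets taken in the order of `δ₀`):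
`P` is affine on the initial segment at EVERY translate of the ball, ties or not. -/
theorem translateIntegral_add_smul_eq_of_lex {a : Dir} (hpos : ∀ k, 0 < h28 a k) {T : ℝ} (hT : 0 < T)
    (hper : ∀ k : Fin 28, ∃ z : ℤ, T * h28 a k = z) {F : Finset (Fin 28) → ℝ}
    (hF : ∀ A, F A = ∑ m ∈ Finset.range ((bkpts a T).card - 1), ((patternN a (bkpt a T m) A : ℤ) : ℝ))
    {δ : Fin 8 → ℝ} {ρb : ℝ} (hρ : ∀ k, |phiForm δ k / h28 a k| < ρb) (hρT : 2 * ρb * T * xMax a ^ 2 < 1)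
    (hc1 : 2 * ρb * xMax a < 1) (hc2 : 2 * ρb * xMax a < wallDist a T) (Δ : Fin 8 → ℝ) {δ₀ : Fin 8 → ℝ}
    (hgen : ∀ k l : Fin 28, k ≠ l → phiForm δ₀ k / h28 a k ≠ phiForm δ₀ l / h28 a l)
    (hlex : ∀ k l : Fin 28, (phiForm δ k / h28 a k < phiForm δ l / h28 a l ∨
        (phiForm δ k / h28 a k = phiForm δ l / h28 a l ∧ phiForm Δ k / h28 a k < phiForm Δ l / h28 a l)) →
      phiForm δ₀ k / h28 a k < phiForm δ₀ l / h28 a l) :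
    ∃ t₀ : ℝ, 0 < t₀ ∧ ∀ t ∈ Icc (0 : ℝ) t₀,
      translateIntegral a T (δ + t • Δ) = translateIntegral a T δ +
        t * ∑ k, (F (Finset.univ.filter fun l => phiForm δ₀ k / h28 a k ≤ phiForm δ₀ l / h28 a l) -
            F (Finset.univ.filter fun l => phiForm δ₀ k / h28 a k < phiForm δ₀ l / h28 a l)) *
          (phiForm Δ k / h28 a k) := by
  obtain ⟨t₁, ht₁, h₁⟩ := rates_le_of_abs_le hρ Δ
  obtain ⟨t₂, ht₂, h₂⟩ := cuspSlope_add_smul_eq_of_lex hpos hT hper hF δ Δ hgen hlex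
  refine ⟨min t₁ t₂, lt_min ht₁ ht₂, fun t ht => ?_⟩
  have hδ' := h₁ t (by rw [abs_of_nonneg ht.1]; exact ht.2.trans (min_le_left _ _))
  have hP := translateIntegral_sub_eq_cuspSlope_sub_of_rates_le hpos hT hper hδ' (fun k => (hρ k).le) hρT hc1 hc2
  have hσ := h₂ t ⟨ht.1, ht.2.trans (min_le_right _ _)⟩
  linarith

/-- **THE ONE-SIDED DIRECTIONAL DERIVATIVE OF `P` EXISTS AT EVERY TRANSLATE OF THE BALL, ALONG EVERY DIRECTION**: under the
hypotheses of `translateIntegral_add_smul_eq_of_lex`, `t ↦ P(δ + t·Δ)` has right derivative `Σ_k W_k(δ₀)·φ_k(Δ)/h_k(a)` at `0` within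
`[0, ∞)`. -/
theorem hasDerivWithinAt_translateIntegral_of_lex {a : Dir} (hpos : ∀ k, 0 < h28 a k) {T : ℝ} (hT : 0 < T)
    (hper : ∀ k : Fin 28, ∃ z : ℤ, T * h28 a k = z) {F : Finset (Fin 28) → ℝ}
    (hF : ∀ A, F A = ∑ m ∈ Finset.range ((bkpts a T).card - 1), ((patternN a (bkpt a T m) A : ℤ) : ℝ))
    {δ : Fin 8 → ℝ} {ρb : ℝ} (hρ : ∀ k, |phiForm δ k / h28 a k| < ρb) (hρT : 2 * ρb * T * xMax a ^ 2 < 1)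
    (hc1 : 2 * ρb * xMax a < 1) (hc2 : 2 * ρb * xMax a < wallDist a T) (Δ : Fin 8 → ℝ) {δ₀ : Fin 8 → ℝ}
    (hgen : ∀ k l : Fin 28, k ≠ l → phiForm δ₀ k / h28 a k ≠ phiForm δ₀ l / h28 a l)
    (hlex : ∀ k l : Fin 28, (phiForm δ k / h28 a k < phiForm δ l / h28 a l ∨
        (phiForm δ k / h28 a k = phiForm δ l / h28 a l ∧ phiForm Δ k / h28 a k < phiForm Δ l / h28 a l)) →
      phiForm δ₀ k / h28 a k < phiForm δ₀ l / h28 a l) :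
    HasDerivWithinAt (fun t : ℝ => translateIntegral a T (δ + t • Δ))
      (∑ k, (F (Finset.univ.filter fun l => phiForm δ₀ k / h28 a k ≤ phiForm δ₀ l / h28 a l) -
            F (Finset.univ.filter fun l => phiForm δ₀ k / h28 a k < phiForm δ₀ l / h28 a l)) *
          (phiForm Δ k / h28 a k)) (Ici 0) 0 := by
  obtain ⟨t₀, ht₀, h⟩ := translateIntegral_add_smul_eq_of_lex hpos hT hper hF hρ hρT hc1 hc2 Δ hgen hlex
  obtain ⟨L, hL⟩ : ∃ L : ℝ, L = ∑ k, (F (Finset.univ.filter fun l => phiForm δ₀ k / h28 a k ≤ phiForm δ₀ l / h28 a l) -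
      F (Finset.univ.filter fun l => phiForm δ₀ k / h28 a k < phiForm δ₀ l / h28 a l)) * (phiForm Δ k / h28 a k) :=
    ⟨_, rfl⟩
  rw [← hL] at h ⊢
  have haff : HasDerivWithinAt (fun t : ℝ => translateIntegral a T δ + t * L) L (Ici 0) 0 := by
    have h1 := ((hasDerivAt_id (0 : ℝ)).mul_const L).const_add (translateIntegral a T δ)
    rw [one_mul] at h1
    exact h1.hasDerivWithinAt
  refine haff.congr_of_eventuallyEq ?_ (by simp)
  filter_upwards [Icc_mem_nhdsGE ht₀] with t ht
  exact h t ht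

/-! ### THE KINK of the translate integral at a resonant translate -/

/-- **THE KINK OF `P` AT A TRANSLATE OF THE BALL ACROSS `Δ`.** Same setting; `δ₀`, `δ₀'` generic references refining the
lexicographic orders of `(δ, Δ)` and `(δ, −Δ)`. Then there is `t₀ > 0` with
**`P(δ + t·Δ) + P(δ − t·Δ) − 2P(δ) = t·Σ_k (W_k(δ₀) − W_k(δ₀'))·φ_k(Δ)/h_k(a)` for all `t ∈ [0, t₀]`** — zero when `δ` has no tie
split by `Δ` (both references may then be taken equal: P2 g40's «no kink at a generic translate»), the difference of two chamber
functionals at a resonant translate. -/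
theorem translateIntegral_symm_add_smul_eq_of_lex {a : Dir} (hpos : ∀ k, 0 < h28 a k) {T : ℝ} (hT : 0 < T)
    (hper : ∀ k : Fin 28, ∃ z : ℤ, T * h28 a k = z) {F : Finset (Fin 28) → ℝ}
    (hF : ∀ A, F A = ∑ m ∈ Finset.range ((bkpts a T).card - 1), ((patternN a (bkpt a T m) A : ℤ) : ℝ))
    {δ : Fin 8 → ℝ} {ρb : ℝ} (hρ : ∀ k, |phiForm δ k / h28 a k| < ρb) (hρT : 2 * ρb * T * xMax a ^ 2 < 1)
    (hc1 : 2 * ρb * xMax a < 1) (hc2 : 2 * ρb * xMax a < wallDist a T) (Δ : Fin 8 → ℝ) {δ₀ δ₀' : Fin 8 → ℝ}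
    (hgen : ∀ k l : Fin 28, k ≠ l → phiForm δ₀ k / h28 a k ≠ phiForm δ₀ l / h28 a l)
    (hgen' : ∀ k l : Fin 28, k ≠ l → phiForm δ₀' k / h28 a k ≠ phiForm δ₀' l / h28 a l)
    (hlex : ∀ k l : Fin 28, (phiForm δ k / h28 a k < phiForm δ l / h28 a l ∨
        (phiForm δ k / h28 a k = phiForm δ l / h28 a l ∧ phiForm Δ k / h28 a k < phiForm Δ l / h28 a l)) →
      phiForm δ₀ k / h28 a k < phiForm δ₀ l / h28 a l)
    (hlex' : ∀ k l : Fin 28, (phiForm δ k / h28 a k < phiForm δ l / h28 a l ∨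
        (phiForm δ k / h28 a k = phiForm δ l / h28 a l ∧ phiForm Δ l / h28 a l < phiForm Δ k / h28 a k)) →
      phiForm δ₀' k / h28 a k < phiForm δ₀' l / h28 a l) :
    ∃ t₀ : ℝ, 0 < t₀ ∧ ∀ t ∈ Icc (0 : ℝ) t₀,
      translateIntegral a T (δ + t • Δ) + translateIntegral a T (δ - t • Δ) - 2 * translateIntegral a T δ =
        t * ∑ k, ((F (Finset.univ.filter fun l => phiForm δ₀ k / h28 a k ≤ phiForm δ₀ l / h28 a l) -
            F (Finset.univ.filter fun l => phiForm δ₀ k / h28 a k < phiForm δ₀ l / h28 a l)) -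
          (F (Finset.univ.filter fun l => phiForm δ₀' k / h28 a k ≤ phiForm δ₀' l / h28 a l) -
            F (Finset.univ.filter fun l => phiForm δ₀' k / h28 a k < phiForm δ₀' l / h28 a l))) *
          (phiForm Δ k / h28 a k) := by
  obtain ⟨t₁, ht₁, h₁⟩ := rates_le_of_abs_le hρ Δ
  obtain ⟨t₂, ht₂, h₂⟩ := cuspSlope_symm_add_smul_eq_of_lex hpos hT hper hF δ Δ hgen hgen' hlex hlex'
  refine ⟨min t₁ t₂, lt_min ht₁ ht₂, fun t ht => ?_⟩
  have ht₁' : |t| ≤ t₁ := by rw [abs_of_nonneg ht.1]; exact ht.2.trans (min_le_left _ _)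
  have hδp := h₁ t ht₁'
  have hδm := h₁ (-t) (by rw [abs_neg]; exact ht₁')
  simp only [neg_smul, ← sub_eq_add_neg] at hδm
  have hPp := translateIntegral_sub_eq_cuspSlope_sub_of_rates_le hpos hT hper hδp (fun k => (hρ k).le) hρT hc1 hc2
  have hPm := translateIntegral_sub_eq_cuspSlope_sub_of_rates_le hpos hT hper hδm (fun k => (hρ k).le) hρT hc1 hc2
  have hσ := h₂ t ⟨ht.1, ht.2.trans (min_le_right _ _)⟩
  linarith

open scoped Classical in
/-- **AT A SIMPLE RATE WALL INSIDE THE BALL THE KINK OF `P` IS AN INTEGER MULTIPLE OF THE WALL COVECTOR, BOUNDED BY THE JUNCTION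
COUNT.** All 28 forms of `a` positive, `T > 0` a period, `F` the canonical period pattern function; `δ` a translate of the open rate
ball with a SIMPLE TIE `ρ_{k₁}(δ) = ρ_{k₂}(δ)` (`k₁ ≠ k₂`, every other pair of rates distinct — a generic point of one rate wall),
`Δ` a direction splitting it (`r_{k₁}(Δ) < r_{k₂}(Δ)`). Then there are an INTEGER `m` — the pooled wall defect
`F(S∪{k₁}) + F(S∪{k₂}) − F(S) − F(S∪{k₁,k₂})`, `S = {j : ρ_{k₁} < ρ_j}` — with
**`|m| ≤ #{m' < #bkpts − 1 : b_{m'}·h_{k₁}(a) ∈ ℤ ∧ b_{m'}·h_{k₂}(a) ∈ ℤ}`** and `t₀ > 0` such that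
**`P(δ + t·Δ) + P(δ − t·Δ) − 2P(δ) = t·m·(r_{k₂}(Δ) − r_{k₁}(Δ))` for all `t ∈ [0, t₀]`.** (Contrast P2 g41's `jumpMass_sub_of_swap`:
ONE swapped pair of crossings, `|m| ≤ 1`; here all the common junctions of `k₁`, `k₂` in the period swap at once.) -/
theorem translateIntegral_kink_of_simple_rate_wall {a : Dir} (hpos : ∀ k, 0 < h28 a k) {T : ℝ} (hT : 0 < T)
    (hper : ∀ k : Fin 28, ∃ z : ℤ, T * h28 a k = z) {F : Finset (Fin 28) → ℝ}
    (hF : ∀ A, F A = ∑ m ∈ Finset.range ((bkpts a T).card - 1), ((patternN a (bkpt a T m) A : ℤ) : ℝ))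
    {δ : Fin 8 → ℝ} {ρb : ℝ} (hρ : ∀ k, |phiForm δ k / h28 a k| < ρb) (hρT : 2 * ρb * T * xMax a ^ 2 < 1)
    (hc1 : 2 * ρb * xMax a < 1) (hc2 : 2 * ρb * xMax a < wallDist a T) {k₁ k₂ : Fin 28} (hne : k₁ ≠ k₂)
    (htie : phiForm δ k₁ / h28 a k₁ = phiForm δ k₂ / h28 a k₂)
    (hsimple : ∀ i j : Fin 28, i ≠ j → phiForm δ i / h28 a i = phiForm δ j / h28 a j →
      (i = k₁ ∧ j = k₂) ∨ (i = k₂ ∧ j = k₁))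
    (Δ : Fin 8 → ℝ) (hsplit : phiForm Δ k₁ / h28 a k₁ < phiForm Δ k₂ / h28 a k₂) :
    ∃ m : ℤ, (m : ℝ) =
        F (insert k₁ (Finset.univ.filter fun j => phiForm δ k₁ / h28 a k₁ < phiForm δ j / h28 a j)) +
          F (insert k₂ (Finset.univ.filter fun j => phiForm δ k₁ / h28 a k₁ < phiForm δ j / h28 a j)) -
          F (Finset.univ.filter fun j => phiForm δ k₁ / h28 a k₁ < phiForm δ j / h28 a j) -
          F (insert k₁ (insert k₂ (Finset.univ.filter fun j => phiForm δ k₁ / h28 a k₁ < phiForm δ j / h28 a j))) ∧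
      |(m : ℝ)| ≤ (((Finset.range ((bkpts a T).card - 1)).filter fun m' =>
        (∃ z : ℤ, bkpt a T m' * h28 a k₁ = z) ∧ ∃ z : ℤ, bkpt a T m' * h28 a k₂ = z).card : ℝ) ∧
      ∃ t₀ : ℝ, 0 < t₀ ∧ ∀ t ∈ Icc (0 : ℝ) t₀,
        translateIntegral a T (δ + t • Δ) + translateIntegral a T (δ - t • Δ) - 2 * translateIntegral a T δ =
          t * ((m : ℝ) * (phiForm Δ k₂ / h28 a k₂ - phiForm Δ k₁ / h28 a k₁)) := by
  obtain ⟨m, hm, hmb, t₂, ht₂, h₂⟩ := cuspSlope_kink_of_simple_tie hpos hT hper hF δ Δ hne htie hsimple hsplit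
  obtain ⟨t₁, ht₁, h₁⟩ := rates_le_of_abs_le hρ Δ
  refine ⟨m, hm, hmb, min t₁ t₂, lt_min ht₁ ht₂, fun t ht => ?_⟩
  have ht₁' : |t| ≤ t₁ := by rw [abs_of_nonneg ht.1]; exact ht.2.trans (min_le_left _ _)
  have hδp := h₁ t ht₁'
  have hδm := h₁ (-t) (by rw [abs_neg]; exact ht₁')
  simp only [neg_smul, ← sub_eq_add_neg] at hδm
  have hPp := translateIntegral_sub_eq_cuspSlope_sub_of_rates_le hpos hT hper hδp (fun k => (hρ k).le) hρT hc1 hc2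
  have hPm := translateIntegral_sub_eq_cuspSlope_sub_of_rates_le hpos hT hper hδm (fun k => (hρ k).le) hρT hc1 hc2
  have hσ := h₂ t ⟨ht.1, ht.2.trans (min_le_right _ _)⟩
  linarith

/-! ### Differentiability at the generic translates of the ball, zero rates allowed -/

/-- **`P` IS DIFFERENTIABLE AT EVERY TRANSLATE OF THE OPEN BALL WITH PAIRWISE DISTINCT RATES — ZERO RATES ALLOWED — with derivative
the canonical chamber functional of `δ`.** All 28 forms of `a` positive, `T > 0` a period, `F` the canonical period pattern
function; `δ` in the open rate ball with pairwise distinct rates. Then `P` is Fréchet-differentiable at `δ` and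
`fderiv ℝ P δ Δ = Σ_k (F(P≤(k)) − F(P<(k)))·φ_k(Δ)/h_k(a)` for every `Δ` (`P = P(0) + σ` on the ball, and near `δ` every translate is
refined by `δ`, where `σ` is the chamber functional of `δ`). -/
theorem hasFDerivAt_translateIntegral_of_rates_lt {a : Dir} (hpos : ∀ k, 0 < h28 a k) {T : ℝ} (hT : 0 < T)
    (hper : ∀ k : Fin 28, ∃ z : ℤ, T * h28 a k = z) {F : Finset (Fin 28) → ℝ}
    (hF : ∀ A, F A = ∑ m ∈ Finset.range ((bkpts a T).card - 1), ((patternN a (bkpt a T m) A : ℤ) : ℝ))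
    {δ : Fin 8 → ℝ} (hgen : ∀ k l : Fin 28, k ≠ l → phiForm δ k / h28 a k ≠ phiForm δ l / h28 a l)
    {ρb : ℝ} (hρ : ∀ k, |phiForm δ k / h28 a k| < ρb) (hρT : 2 * ρb * T * xMax a ^ 2 < 1)
    (hc1 : 2 * ρb * xMax a < 1) (hc2 : 2 * ρb * xMax a < wallDist a T) :
    DifferentiableAt ℝ (translateIntegral a T) δ ∧ ∀ Δ : Fin 8 → ℝ, fderiv ℝ (translateIntegral a T) δ Δ =
      ∑ k, (F (Finset.univ.filter fun l => phiForm δ k / h28 a k ≤ phiForm δ l / h28 a l) -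
          F (Finset.univ.filter fun l => phiForm δ k / h28 a k < phiForm δ l / h28 a l)) *
        (phiForm Δ k / h28 a k) := by
  -- the chamber functional of `δ` as a continuous linear map
  set W : Fin 28 → ℝ := fun k => F (Finset.univ.filter fun l => phiForm δ k / h28 a k ≤ phiForm δ l / h28 a l) -
      F (Finset.univ.filter fun l => phiForm δ k / h28 a k < phiForm δ l / h28 a l) with hW
  let Lₗ : (Fin 8 → ℝ) →ₗ[ℝ] ℝ :=
    { toFun := fun Δ => ∑ k, W k * (phiForm Δ k / h28 a k)
      map_add' := fun Δ Δ' => by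
        rw [← Finset.sum_add_distrib]
        exact Finset.sum_congr rfl fun k _ => by rw [phiForm_add]; ring
      map_smul' := fun c Δ => by
        rw [RingHom.id_apply, smul_eq_mul, Finset.mul_sum]
        exact Finset.sum_congr rfl fun k _ => by rw [phiForm_smul]; ring }
  set L : (Fin 8 → ℝ) →L[ℝ] ℝ := LinearMap.toContinuousLinearMap Lₗ with hL
  have hLapply : ∀ Δ, L Δ = ∑ k, W k * (phiForm Δ k / h28 a k) := fun Δ => rfl
  -- `σ` is the functional of `δ` at every translate refined by `δ`
  have hσ : ∀ δ' : Fin 8 → ℝ, (∀ k l : Fin 28, phiForm δ' k / h28 a k < phiForm δ' l / h28 a l →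
      phiForm δ k / h28 a k < phiForm δ l / h28 a l) → cuspSlope a T δ' = L δ' := fun δ' href => by
    rw [hLapply]; exact cuspSlope_eq_greedy_canonical_of_refines hpos hT hper hF hgen δ' href
  -- near `δ`: refined by `δ` and inside the ball
  have hnear : ∀ᶠ δ' in 𝓝 δ, (∀ k l : Fin 28, phiForm δ' k / h28 a k < phiForm δ' l / h28 a l →
      phiForm δ k / h28 a k < phiForm δ l / h28 a l) ∧ ∀ k, |phiForm δ' k / h28 a k| ≤ ρb := by
    have hc : ∀ k, Continuous fun θ : Fin 8 → ℝ => phiForm θ k / h28 a k := fun k =>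
      (continuous_phiForm k).div_const _
    refine Filter.Eventually.and ?_ ?_
    · rw [Filter.eventually_all]
      intro k
      rw [Filter.eventually_all]
      intro l
      by_cases hkl : phiForm δ k / h28 a k < phiForm δ l / h28 a l
      · exact Filter.Eventually.of_forall fun _ _ => hkl
      · by_cases hkl' : k = l
        · subst hkl'; exact Filter.Eventually.of_forall fun _ h => absurd h (lt_irrefl _)
        have hlt : phiForm δ l / h28 a l < phiForm δ k / h28 a k :=
          lt_of_le_of_ne (not_lt.mp hkl) (hgen l k (Ne.symm hkl'))
        filter_upwards [((hc l).continuousAt).eventually_lt ((hc k).continuousAt) hlt] with δ' h h'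
        exact absurd (h.trans h') (lt_irrefl _)
    · rw [Filter.eventually_all]
      intro k
      filter_upwards [((hc k).abs.continuousAt).eventually_lt continuousAt_const (hρ k)] with δ' h
      exact h.le
  -- on that neighbourhood `P` is the affine map `P(δ) + L(δ' − δ)`
  have haff : (fun δ' => translateIntegral a T δ + (L δ' - L δ)) =ᶠ[𝓝 δ] translateIntegral a T := by
    filter_upwards [hnear] with δ' hδ'
    have hP := translateIntegral_sub_eq_cuspSlope_sub_of_rates_le hpos hT hper hδ'.2 (fun k => (hρ k).le) hρT hc1 hc2
    rw [hσ δ' hδ'.1, hσ δ (fun k l h => h)] at hP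
    linarith
  have hderiv : HasFDerivAt (translateIntegral a T) L δ := by
    have h1 : HasFDerivAt (fun δ' => translateIntegral a T δ + (L δ' - L δ)) L δ :=
      (L.hasFDerivAt.sub_const (L δ)).const_add (translateIntegral a T δ)
    exact h1.congr_of_eventuallyEq haff.symm
  exact ⟨hderiv.differentiableAt, fun Δ => by rw [hderiv.fderiv, hLapply]⟩

end Summit.KontsevichZagierPeriods.Zeta5Search.Barrier.ConeGamma

end
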